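import Summits.RiemannHypothesis.RiemannHypothesis.Theses.LiAsymptotic
import Summits.RiemannHypothesis.RiemannHypothesis.Theorems.LiAsymptoticLiLowZerosTrivial
import HarnessLib

/-!
# RiemannHypothesis / LiAsymptotic — support item `LiLowZerosTrivial` closed BY NAME (RH-FREE)

RH-FREE [rh-li-prover].  Route `Theses/LiAsymptotic.lean` (rung L-P(P1⁺)), support item `LiLowZerosTrivial`
(stmt-RiemannHypothesis-19230, registered at the tribunal's J request): the zeros below height `a` counted trivially,
`|2 Σ_{0<Im ρ≤a} m f_n(Im ρ) − 2 liCountMain a| ≤ 2 liCountMain a + 4(0.3083 log a + 4.128)` (`a ≥ 30`) — the landed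
theorem `liLowZerosTrivial_bound` (`Theorems/LiAsymptoticLiLowZerosTrivial.lean`) restated with the route decl as its
type.  Nothing here bears on the truth of RH.
-/

noncomputable section

-- D-0017: `Summit.<S>.<S>.…` is the designed namespace of a single-problem summit.
set_option linter.dupNamespace false

namespace Summit.RiemannHypothesis.RiemannHypothesis.Theorems.LiTheory

/-- **Item `LiLowZerosTrivial` of route `LiAsymptotic`** (stmt-RiemannHypothesis-19230; RH-FREE zero counting),
closed BY NAME by the landed `liLowZerosTrivial_bound`. -/
theorem liLowZerosTrivial_proof :
    Summit.RiemannHypothesis.RiemannHypothesis.Theses.LiAsymptotic.LiLowZerosTrivial :=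
  liLowZerosTrivial_bound

end Summit.RiemannHypothesis.RiemannHypothesis.Theorems.LiTheory

end
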